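import Mathlib
import Literature.NumberTheory.LFunctions.Zhang2022.Section8cStatements
import HarnessLib

/-!
# Zhang (2022) §8 p. 48 — `λ₀ⱼ(q) = (1 − q⁻¹)²(1 + O(α log q/q))` at a prime `q`
# (`Z22:§8.u047`, first equality): discharge of `Section8cStatements.Step8u047local`

Topic `Literature/NumberTheory/LFunctions/Zhang2022` (Landau–Siegel audit tree; verdict-neutral).
Y. Zhang, *Discrete mean estimates and the Landau–Siegel zero*, arXiv:2211.02515v1 (2022)
[Zhang2022LandauSiegel] — **an unrefereed manuscript under adjudication** (D-0069 campaign, cell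
`siegel-zhang`, discharge seat d16). This file PROVES the first equality of the display before
(8.11) on p. 48 (tex L2459), "`λ₀ⱼ(n) = ∏_{q∣n}(1 − q⁻¹)²(1 + O(α log q/q))`", in its typed form
`Section8cStatements.Step8u047local c′` (slice L2-t8):

* `step8u047local_holds : Step8u047local c′` — DISCHARGED for every `c′`: for all large `D`, every
  prime `q` (the printed `q < P` is not needed) and every `j`,
  `‖λ₀ⱼ(q) − (1 − q⁻¹)²‖ ≤ 840 (1 − q⁻¹)² · α log q / q`.

Proof. `λ₀ⱼ(q) = λ(q, 1 − β_j)` (§7 p. 33) is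
`(1 − q^{−1−i(b₁−b_j)})(1 − q^{−1−i(b₂−b_j)})(1 − q^{−1−i(b₃−b_j)})/(1 − q^{−1+ib_j})` with the real
shift sizes `b_k` of (2.13) (`β_k = ib_k`, `beta1_eq`…; `|b_k| ≤ 6α` once `|c′|α𝓛 ≤ 1`, `abs_b_le`),
`‖q^{−(1+iθ)} − q⁻¹‖ ≤ |θ| log q / q` (`norm_natCast_cpow_neg_one_add_sub_inv_le`, from
`|e^{it} − 1| ≤ |t|`), and the pure algebra `norm_localFactor_sub_le`
(`‖(1−u₁)(1−u₂)(1−u₃)/(1−u₀) − (1−v)²‖ ≤ (9/2)Σ‖uᵢ − v‖ + 4‖u₀ − v‖` for `‖uᵢ‖, v ≤ 1/2`).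
`large_D` records the standing "D large" bookkeeping (`𝓛 ≥ 5`, `α > 0`, `|c′|α𝓛 ≤ 1` for
`D ≥ ⌈exp(π|c′| + 5)⌉`). The companion file `Section8LambdaZeroGlobal` multiplies this over `q ∣ n`.

WHAT THIS IS NOT: any claim about Theorems 1–2 of the manuscript or about Landau–Siegel zeros.

## References

* Y. Zhang, arXiv:2211.02515v1 (2022), §8 p. 48, display before (8.11) (tex L2459); §7 p. 33
  (`λ(m,s)`, `λ₀ⱼ`); (2.13). [cite: Zhang2022LandauSiegel, §8 p.48]
-/

noncomputable section

open Complex Real ComplexConjugate Set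

namespace Literature.NumberTheory.LFunctions.Zhang2022.Section8cProofs

open Literature.NumberTheory.LFunctions.Zhang2022.Skeleton

/-! ## Elementary estimates for `q^{-(1+iθ)}` -/

/-- For a natural number `q ≥ 1` and real `θ`: `q^{-(1+iθ)} = q⁻¹ · e^{i(-θ log q)}`. [folklore] -/
private theorem natCast_cpow_neg_one_add (q : ℕ) (hq : 0 < q) (θ : ℝ) :
    (q : ℂ) ^ (-(1 + θ * I)) = (q : ℂ)⁻¹ * cexp (I * ((-(θ * Real.log q) : ℝ) : ℂ)) := by
  have hq0 : (q : ℂ) ≠ 0 := by exact_mod_cast hq.ne'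
  have hinv : ((q : ℂ))⁻¹ = cexp (-(Real.log q : ℂ)) := by
    rw [Complex.exp_neg, Complex.natCast_log, Complex.exp_log hq0]
  rw [cpow_def_of_ne_zero hq0, ← Complex.natCast_log, hinv, ← Complex.exp_add]
  congr 1
  push_cast
  ring

/-- `‖q^{-(1+iθ)}‖ = q⁻¹`. [folklore] -/
private theorem norm_natCast_cpow_neg_one_add (q : ℕ) (hq : 0 < q) (θ : ℝ) :
    ‖(q : ℂ) ^ (-(1 + θ * I))‖ = (q : ℝ)⁻¹ := by
  rw [natCast_cpow_neg_one_add q hq θ, norm_mul, Complex.norm_exp_I_mul_ofReal, mul_one,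
    norm_inv, Complex.norm_natCast]

/-- `‖q^{-(1+iθ)} − q⁻¹‖ ≤ |θ| log q / q`. [folklore] -/
private theorem norm_natCast_cpow_neg_one_add_sub_inv_le (q : ℕ) (hq : 0 < q) (θ : ℝ) :
    ‖(q : ℂ) ^ (-(1 + θ * I)) - (q : ℂ)⁻¹‖ ≤ |θ| * Real.log q / q := by
  rw [natCast_cpow_neg_one_add q hq θ]
  have h1 : (q : ℂ)⁻¹ * cexp (I * ((-(θ * Real.log q) : ℝ) : ℂ)) - (q : ℂ)⁻¹ =
      (q : ℂ)⁻¹ * (cexp (I * ((-(θ * Real.log q) : ℝ) : ℂ)) - 1) := by ring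
  rw [h1, norm_mul, norm_inv, Complex.norm_natCast]
  have h2 := @Real.norm_exp_I_mul_ofReal_sub_one_le (-(θ * Real.log q))
  have hlog : 0 ≤ Real.log q := Real.log_natCast_nonneg q
  rw [Real.norm_eq_abs, abs_neg, abs_mul, abs_of_nonneg hlog] at h2
  have hq' : (0 : ℝ) < q := by exact_mod_cast hq
  calc (q : ℝ)⁻¹ * ‖cexp (I * ((-(θ * Real.log q) : ℝ) : ℂ)) - 1‖
      ≤ (q : ℝ)⁻¹ * (|θ| * Real.log q) := by gcongr
    _ = |θ| * Real.log q / q := by rw [div_eq_inv_mul]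

/-! ## The pure algebra of the local factor -/

/-- If `‖uᵢ‖ ≤ 1/2`, `0 ≤ v ≤ 1/2` and `‖uᵢ − v‖ ≤ εᵢ` then
`‖(1−u₁)(1−u₂)(1−u₃)/(1−u₀) − (1−v)²‖ ≤ (9/2)(ε₁+ε₂+ε₃) + 4ε₀`. [folklore] -/
private theorem norm_localFactor_sub_le {u₁ u₂ u₃ u₀ : ℂ} {v ε₁ ε₂ ε₃ ε₀ : ℝ} (hv0 : 0 ≤ v)
    (hv : v ≤ 1 / 2) (hu₂ : ‖u₂‖ ≤ 1 / 2) (hu₃ : ‖u₃‖ ≤ 1 / 2)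
    (hu₀ : ‖u₀‖ ≤ 1 / 2) (he₁ : ‖u₁ - v‖ ≤ ε₁) (he₂ : ‖u₂ - v‖ ≤ ε₂) (he₃ : ‖u₃ - v‖ ≤ ε₃)
    (he₀ : ‖u₀ - v‖ ≤ ε₀) :
    ‖(1 - u₁) * (1 - u₂) * (1 - u₃) / (1 - u₀) - (1 - (v : ℂ)) ^ 2‖ ≤
      9 / 2 * (ε₁ + ε₂ + ε₃) + 4 * ε₀ := by
  have hB : (1 : ℝ) / 2 ≤ ‖1 - u₀‖ := by
    have := norm_sub_norm_le (1 : ℂ) u₀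
    rw [norm_one] at this
    linarith
  have hB0 : (1 - u₀) ≠ 0 := by
    intro h; rw [h, norm_zero] at hB; linarith
  have hv1 : ‖(1 : ℂ) - v‖ ≤ 1 := by
    rw [← Complex.ofReal_one, ← Complex.ofReal_sub, Complex.norm_real, Real.norm_eq_abs,
      abs_of_nonneg (by linarith)]
    linarith
  have hv2 : (1 : ℝ) / 2 ≤ ‖(1 : ℂ) - v‖ := by
    rw [← Complex.ofReal_one, ← Complex.ofReal_sub, Complex.norm_real, Real.norm_eq_abs,
      abs_of_nonneg (by linarith)]
    linarith
  have hv3 : ((1 : ℂ) - v) ≠ 0 := by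
    intro h; rw [h, norm_zero] at hv2; linarith
  have h1u₂ : ‖1 - u₂‖ ≤ 3 / 2 := by
    calc ‖1 - u₂‖ ≤ ‖(1 : ℂ)‖ + ‖u₂‖ := norm_sub_le _ _
      _ ≤ 1 + 1 / 2 := by rw [norm_one]; gcongr
      _ = 3 / 2 := by norm_num
  have h1u₃ : ‖1 - u₃‖ ≤ 3 / 2 := by
    calc ‖1 - u₃‖ ≤ ‖(1 : ℂ)‖ + ‖u₃‖ := norm_sub_le _ _
      _ ≤ 1 + 1 / 2 := by rw [norm_one]; gcongr
      _ = 3 / 2 := by norm_num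
  -- `A − A₀`
  set A : ℂ := (1 - u₁) * (1 - u₂) * (1 - u₃) with hA
  set A₀ : ℂ := (1 - (v : ℂ)) ^ 3 with hA₀
  have hAA : A - A₀ = ((v : ℂ) - u₁) * (1 - u₂) * (1 - u₃) +
      (1 - (v : ℂ)) * (((v : ℂ) - u₂) * (1 - u₃)) + (1 - (v : ℂ)) ^ 2 * ((v : ℂ) - u₃) := by
    rw [hA, hA₀]; ring
  have hε₁ : 0 ≤ ε₁ := le_trans (norm_nonneg _) he₁
  have hε₂ : 0 ≤ ε₂ := le_trans (norm_nonneg _) he₂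
  have hε₃ : 0 ≤ ε₃ := le_trans (norm_nonneg _) he₃
  have hε₀ : 0 ≤ ε₀ := le_trans (norm_nonneg _) he₀
  have he₁' : ‖(v : ℂ) - u₁‖ ≤ ε₁ := by rw [norm_sub_rev]; exact he₁
  have he₂' : ‖(v : ℂ) - u₂‖ ≤ ε₂ := by rw [norm_sub_rev]; exact he₂
  have he₃' : ‖(v : ℂ) - u₃‖ ≤ ε₃ := by rw [norm_sub_rev]; exact he₃
  have he₀' : ‖(1 - (v : ℂ)) - (1 - u₀)‖ ≤ ε₀ := by
    rw [show (1 - (v : ℂ)) - (1 - u₀) = u₀ - v by ring]; exact he₀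
  have hAA' : ‖A - A₀‖ ≤ 9 / 4 * (ε₁ + ε₂ + ε₃) := by
    rw [hAA]
    calc ‖((v : ℂ) - u₁) * (1 - u₂) * (1 - u₃) + (1 - (v : ℂ)) * (((v : ℂ) - u₂) * (1 - u₃)) +
            (1 - (v : ℂ)) ^ 2 * ((v : ℂ) - u₃)‖
        ≤ ‖((v : ℂ) - u₁) * (1 - u₂) * (1 - u₃)‖ + ‖(1 - (v : ℂ)) * (((v : ℂ) - u₂) * (1 - u₃))‖ +
            ‖(1 - (v : ℂ)) ^ 2 * ((v : ℂ) - u₃)‖ := norm_add₃_le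
      _ = ‖(v : ℂ) - u₁‖ * ‖1 - u₂‖ * ‖1 - u₃‖ + ‖1 - (v : ℂ)‖ * (‖(v : ℂ) - u₂‖ * ‖1 - u₃‖) +
            ‖1 - (v : ℂ)‖ ^ 2 * ‖(v : ℂ) - u₃‖ := by
          simp only [norm_mul, norm_pow]
      _ ≤ ε₁ * (3 / 2) * (3 / 2) + 1 * (ε₂ * (3 / 2)) + 1 ^ 2 * ε₃ := by
          gcongr
      _ ≤ 9 / 4 * (ε₁ + ε₂ + ε₃) := by nlinarith
  have hA₀n : ‖A₀‖ ≤ 1 := by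
    rw [hA₀, norm_pow]
    calc ‖(1 : ℂ) - v‖ ^ 3 ≤ 1 ^ 3 := by gcongr
      _ = 1 := by norm_num
  -- the decomposition
  have hdec : A / (1 - u₀) - (1 - (v : ℂ)) ^ 2 =
      (A - A₀) / (1 - u₀) + A₀ * (((1 - (v : ℂ)) - (1 - u₀)) / ((1 - u₀) * (1 - (v : ℂ)))) := by
    rw [hA₀]
    field_simp
    ring
  rw [hdec]
  calc ‖(A - A₀) / (1 - u₀) + A₀ * (((1 - (v : ℂ)) - (1 - u₀)) / ((1 - u₀) * (1 - (v : ℂ))))‖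
      ≤ ‖(A - A₀) / (1 - u₀)‖ + ‖A₀ * (((1 - (v : ℂ)) - (1 - u₀)) / ((1 - u₀) * (1 - (v : ℂ))))‖ :=
        norm_add_le _ _
    _ = ‖A - A₀‖ / ‖1 - u₀‖ + ‖A₀‖ * (‖(1 - (v : ℂ)) - (1 - u₀)‖ / (‖1 - u₀‖ * ‖1 - (v : ℂ)‖)) := by
        simp only [norm_div, norm_mul]
    _ ≤ (9 / 4 * (ε₁ + ε₂ + ε₃)) / (1 / 2) + 1 * (ε₀ / ((1 / 2) * (1 / 2))) := by
        gcongr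
    _ = 9 / 2 * (ε₁ + ε₂ + ε₃) + 4 * ε₀ := by ring


/-! ## The shifts `β_j` as real multiples of `i` -/

/-- `β₁ = i b₁`. [cite: Zhang2022LandauSiegel, §2 (2.13)] -/
theorem beta1_eq (c' : ℝ) (D : ℕ) : beta1 c' D = ((b1 c' D : ℝ) : ℂ) * I := by
  unfold beta1 b1; push_cast; ring

/-- `β₂ = i b₂`. [cite: Zhang2022LandauSiegel, §2 (2.13)] -/
theorem beta2_eq (c' : ℝ) (D : ℕ) : beta2 c' D = ((b2 c' D : ℝ) : ℂ) * I := by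
  unfold beta2 b2; push_cast; ring

/-- `β₃ = i b₃`. [cite: Zhang2022LandauSiegel, §2 (2.13)] -/
theorem beta3_eq (c' : ℝ) (D : ℕ) : beta3 c' D = ((b3 c' D : ℝ) : ℂ) * I := by
  unfold beta3 b3; push_cast; ring

/-- `β_j = i b` with `b ∈ {b₁, b₂, b₃}`. [cite: Zhang2022LandauSiegel, §2 (2.13)] -/
theorem betaJ_eq_real_mul_I (c' : ℝ) (D j : ℕ) :
    ∃ b : ℝ, betaJ c' D j = (b : ℂ) * I ∧ (b = b1 c' D ∨ b = b2 c' D ∨ b = b3 c' D) := by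
  unfold betaJ
  split_ifs
  · exact ⟨b1 c' D, beta1_eq c' D, Or.inl rfl⟩
  · exact ⟨b2 c' D, beta2_eq c' D, Or.inr (Or.inl rfl)⟩
  · exact ⟨b3 c' D, beta3_eq c' D, Or.inr (Or.inr rfl)⟩

/-- `|b_k| ≤ 6α` once `|c′|α𝓛 ≤ 1`. [cite: Zhang2022LandauSiegel, §2 (2.13)] -/
theorem abs_b_le {c' : ℝ} {D : ℕ} (h : |c'| * alpha D * ell D ≤ 1) (hα : 0 ≤ alpha D)
    (hℓ : 0 ≤ ell D) {b : ℝ} (hb : b = b1 c' D ∨ b = b2 c' D ∨ b = b3 c' D) :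
    |b| ≤ 6 * alpha D := by
  have hx : |c' * alpha D * ell D| ≤ 1 := by
    rwa [abs_mul, abs_mul, abs_of_nonneg hα, abs_of_nonneg hℓ]
  rcases hb with rfl | rfl | rfl
  · rw [b1, abs_mul, abs_of_nonneg hα]
    have : |1 - 5 * c' * alpha D * ell D| ≤ 6 := by
      calc |1 - 5 * c' * alpha D * ell D| ≤ |(1 : ℝ)| + |5 * c' * alpha D * ell D| := abs_sub _ _
        _ = 1 + 5 * |c' * alpha D * ell D| := by
            rw [abs_one, show 5 * c' * alpha D * ell D = 5 * (c' * alpha D * ell D) by ring,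
              abs_mul, abs_of_pos (by norm_num : (0:ℝ) < 5)]
        _ ≤ 1 + 5 * 1 := by gcongr
        _ = 6 := by norm_num
    nlinarith
  · rw [b2, abs_mul, abs_mul, abs_of_pos (by norm_num : (0:ℝ) < 2), abs_of_nonneg hα]
    have : |1 + c' * alpha D * ell D| ≤ 2 := by
      calc |1 + c' * alpha D * ell D| ≤ |(1 : ℝ)| + |c' * alpha D * ell D| := abs_add_le _ _
        _ ≤ 1 + 1 := by rw [abs_one]; gcongr
        _ = 2 := by norm_num
    nlinarith
  · rw [b3, abs_mul, abs_mul, abs_of_pos (by norm_num : (0:ℝ) < 3), abs_of_nonneg hα]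
    have : |1 - c' * alpha D * ell D| ≤ 2 := by
      calc |1 - c' * alpha D * ell D| ≤ |(1 : ℝ)| + |c' * alpha D * ell D| := abs_sub _ _
        _ ≤ 1 + 1 := by rw [abs_one]; gcongr
        _ = 2 := by norm_num
    nlinarith

/-! ## The local factor `λ₀ⱼ(q)` at a prime `q` -/

/-- **Pointwise form of `Z22:§8.u047` (local factor)**: for every prime `q`, every `j` and every
`D` with `|c′|α𝓛 ≤ 1`, `‖λ₀ⱼ(q) − (1 − q⁻¹)²‖ ≤ 210 · α log q / q`. [cite: Zhang2022LandauSiegel, §8 p.48 display before (8.11), tex L2459] -/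
theorem norm_lamZero_prime_sub_le {c' : ℝ} {D : ℕ} (h : |c'| * alpha D * ell D ≤ 1)
    (hα : 0 ≤ alpha D) (hℓ : 0 ≤ ell D) (j : ℕ) {q : ℕ} (hq : q.Prime) :
    ‖lamZero c' D j q - (1 - (q : ℂ)⁻¹) ^ 2‖ ≤ 210 * (alpha D * Real.log q / q) := by
  obtain ⟨bj, hbj, hbj'⟩ := betaJ_eq_real_mul_I c' D j
  have hq0 : 0 < q := hq.pos
  have hq2 : (2 : ℝ) ≤ q := by exact_mod_cast hq.two_le
  have hqr : (0 : ℝ) < q := by exact_mod_cast hq0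
  unfold lamZero lam
  rw [Nat.Prime.primeFactors hq, Finset.prod_singleton, hbj, beta1_eq, beta2_eq, beta3_eq]
  have e1 : -((1 - (bj : ℂ) * I) + ((b1 c' D : ℝ) : ℂ) * I) =
      -(1 + (((b1 c' D - bj : ℝ)) : ℂ) * I) := by push_cast; ring
  have e2 : -((1 - (bj : ℂ) * I) + ((b2 c' D : ℝ) : ℂ) * I) =
      -(1 + (((b2 c' D - bj : ℝ)) : ℂ) * I) := by push_cast; ring
  have e3 : -((1 - (bj : ℂ) * I) + ((b3 c' D : ℝ) : ℂ) * I) =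
      -(1 + (((b3 c' D - bj : ℝ)) : ℂ) * I) := by push_cast; ring
  have e0 : -(1 - (bj : ℂ) * I) = -(1 + (((-bj : ℝ)) : ℂ) * I) := by push_cast; ring
  rw [e1, e2, e3, e0]
  have hvq : ((q : ℂ))⁻¹ = (((q : ℝ)⁻¹ : ℝ) : ℂ) := by push_cast; rfl
  rw [hvq]
  -- bounds on the θ's
  have hbj6 : |bj| ≤ 6 * alpha D := abs_b_le h hα hℓ hbj'
  have hb1 : |b1 c' D| ≤ 6 * alpha D := abs_b_le h hα hℓ (Or.inl rfl)
  have hb2 : |b2 c' D| ≤ 6 * alpha D := abs_b_le h hα hℓ (Or.inr (Or.inl rfl))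
  have hb3 : |b3 c' D| ≤ 6 * alpha D := abs_b_le h hα hℓ (Or.inr (Or.inr rfl))
  have hθ1 : |b1 c' D - bj| ≤ 12 * alpha D := by
    calc |b1 c' D - bj| ≤ |b1 c' D| + |bj| := abs_sub _ _
      _ ≤ 6 * alpha D + 6 * alpha D := by gcongr
      _ = 12 * alpha D := by ring
  have hθ2 : |b2 c' D - bj| ≤ 12 * alpha D := by
    calc |b2 c' D - bj| ≤ |b2 c' D| + |bj| := abs_sub _ _
      _ ≤ 6 * alpha D + 6 * alpha D := by gcongr
      _ = 12 * alpha D := by ring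
  have hθ3 : |b3 c' D - bj| ≤ 12 * alpha D := by
    calc |b3 c' D - bj| ≤ |b3 c' D| + |bj| := abs_sub _ _
      _ ≤ 6 * alpha D + 6 * alpha D := by gcongr
      _ = 12 * alpha D := by ring
  have hθ0 : |(-bj)| ≤ 12 * alpha D := by rw [abs_neg]; linarith
  have hlog : 0 ≤ Real.log q := Real.log_natCast_nonneg q
  -- the ε's
  have hE : ∀ θ : ℝ, |θ| ≤ 12 * alpha D →
      ‖(q : ℂ) ^ (-(1 + (θ : ℂ) * I)) - (((q : ℝ)⁻¹ : ℝ) : ℂ)‖ ≤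
        12 * alpha D * Real.log q / q := by
    intro θ hθ
    have := norm_natCast_cpow_neg_one_add_sub_inv_le q hq0 θ
    rw [hvq] at this
    calc _ ≤ |θ| * Real.log q / q := this
      _ ≤ 12 * alpha D * Real.log q / q := by gcongr
  have hN : ∀ θ : ℝ, ‖(q : ℂ) ^ (-(1 + (θ : ℂ) * I))‖ ≤ 1 / 2 := by
    intro θ
    rw [norm_natCast_cpow_neg_one_add q hq0 θ]
    rw [inv_eq_one_div]
    exact one_div_le_one_div_of_le (by norm_num) hq2
  have hv0 : (0 : ℝ) ≤ (q : ℝ)⁻¹ := by positivity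
  have hv : (q : ℝ)⁻¹ ≤ 1 / 2 := by
    rw [inv_eq_one_div]; exact one_div_le_one_div_of_le (by norm_num) hq2
  have key := norm_localFactor_sub_le (u₁ := (q : ℂ) ^ (-(1 + (((b1 c' D - bj : ℝ)) : ℂ) * I)))
    (u₂ := (q : ℂ) ^ (-(1 + (((b2 c' D - bj : ℝ)) : ℂ) * I)))
    (u₃ := (q : ℂ) ^ (-(1 + (((b3 c' D - bj : ℝ)) : ℂ) * I)))
    (u₀ := (q : ℂ) ^ (-(1 + (((-bj : ℝ)) : ℂ) * I)))
    hv0 hv (hN _) (hN _) (hN _) (hE _ hθ1) (hE _ hθ2) (hE _ hθ3) (hE _ hθ0)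
  calc _ ≤ 9 / 2 * (12 * alpha D * Real.log q / q + 12 * alpha D * Real.log q / q +
        12 * alpha D * Real.log q / q) + 4 * (12 * alpha D * Real.log q / q) := key
    _ = 210 * (alpha D * Real.log q / q) := by ring


/-! ## `D` large: the standing smallness conditions -/

/-- For `D ≥ ⌈exp(π|c′| + 5)⌉`: `𝓛 ≥ 5`, `α > 0`, and `|c′|α𝓛 ≤ 1`. [cite: Zhang2022LandauSiegel, §2 (2.6), (2.10)] -/
theorem large_D {c' : ℝ} {D : ℕ} (hD : ⌈Real.exp (π * |c'| + 5)⌉₊ ≤ D) :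
    5 ≤ ell D ∧ 0 < alpha D ∧ |c'| * alpha D * ell D ≤ 1 := by
  have hexp : Real.exp (π * |c'| + 5) ≤ D := le_trans (Nat.le_ceil _) (by exact_mod_cast hD)
  have hDpos : (0 : ℝ) < D := lt_of_lt_of_le (Real.exp_pos _) hexp
  have hlog : π * |c'| + 5 ≤ Real.log D := (Real.le_log_iff_exp_le hDpos).mpr hexp
  have hπc : 0 ≤ π * |c'| := by positivity
  have hL5 : 5 ≤ ell D := by rw [ell]; linarith
  have hL1 : 1 ≤ ell D := by linarith
  have hLpos : 0 < ell D := by linarith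
  have hα : alpha D = π / ell D ^ 9 := by rw [alpha, bigP, Real.log_exp]
  refine ⟨hL5, ?_, ?_⟩
  · rw [hα]; positivity
  · rw [hα]
    have h8 : ell D ≤ ell D ^ 8 := by
      calc ell D = ell D ^ 1 := (pow_one _).symm
        _ ≤ ell D ^ 8 := pow_le_pow_right₀ hL1 (by norm_num)
    have hπcL : π * |c'| ≤ ell D ^ 8 := by rw [ell] at h8 ⊢; linarith
    rw [show |c'| * (π / ell D ^ 9) * ell D = (π * |c'|) / ell D ^ 8 by
      field_simp]
    rw [div_le_one (by positivity)]
    exact hπcL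

/-- **`Z22:§8.u047`, local form, DISCHARGED** (constant `840`, any `c′`, every prime `q`; the
printed restriction `q < P` is not needed). [cite: Zhang2022LandauSiegel, §8 p.48 display before (8.11), tex L2459] -/
theorem step8u047local_holds (c' : ℝ) : Section8cStatements.Step8u047local c' := by
  refine ⟨840, ⌈Real.exp (π * |c'| + 5)⌉₊, fun D _ χ hD _ _ j _ q hq _ => ?_⟩
  obtain ⟨hL5, hαpos, hsmall⟩ := large_D hD
  have hℓ : 0 ≤ ell D := by linarith
  have key := norm_lamZero_prime_sub_le hsmall hαpos.le hℓ j hq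
  have hq2 : (2 : ℝ) ≤ q := by exact_mod_cast hq.two_le
  have hqpos : (0 : ℝ) < q := by linarith
  have hm : (1 : ℝ) / 4 ≤ (1 - (q : ℝ)⁻¹) ^ 2 := by
    have : (1 : ℝ) / 2 ≤ 1 - (q : ℝ)⁻¹ := by
      rw [inv_eq_one_div]
      have := one_div_le_one_div_of_le (by norm_num : (0:ℝ) < 2) hq2
      linarith
    nlinarith
  have hx : 0 ≤ alpha D * Real.log q / q := by
    have := Real.log_natCast_nonneg q
    positivity
  calc _ ≤ 210 * (alpha D * Real.log q / q) := key
    _ = 840 * (1 / 4) * (alpha D * Real.log q / q) := by ring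
    _ ≤ 840 * (1 - (q : ℝ)⁻¹) ^ 2 * (alpha D * Real.log q / q) := by gcongr

variable (c' : ℝ) in
/-- `Step8u047local` — `_holds` alias of `step8u047local_holds` above under the fact's exact name, stated under the
prover's own binders as section variables (appended 2026-08-28, D-0026 bookkeeping: the proof term is the
existing theorem of this file; no statement, definition or attribute is edited; no new named fact; the
ledger's debt table listed the fact unproved). [cite: Zhang2022LandauSiegel, §8 p.48 display before (8.11), tex L2459] -/
theorem _root_.Literature.NumberTheory.LFunctions.Zhang2022.Section8cStatements.Step8u047local_holds :
    _root_.Literature.NumberTheory.LFunctions.Zhang2022.Section8cStatements.Step8u047local c' :=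
  _root_.Literature.NumberTheory.LFunctions.Zhang2022.Section8cProofs.step8u047local_holds (c' := c')

end Literature.NumberTheory.LFunctions.Zhang2022.Section8cProofs
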